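import Literature.MathematicalPhysics.QuantumFieldTheory.Balaban1983to89.B1Prop22Proof
import Literature.MathematicalPhysics.QuantumFieldTheory.Balaban1983to89.B1Prop22RegularFieldAlg

/-!
# `Balaban1983to89.B1Prop22RegularField` — T. Bałaban, *(Higgs)₂,₃ quantum fields in a finite volume. I. A lower bound*,
# Commun. Math. Phys. **85** (1982) 603–626 [Balaban1982Higgs1]: **Proposition 2.2** (2.27)–(2.29) p. 611 AT `A ≠ 0` —
# the MODEL INSTANCE of `…B1.Prop22Small` on the B4 cell's family of REGULAR-FIELD REGION PAIRS (every mesh, every nested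
# pair of finite unions of unit blocks, every mass `m² ≥ 0`, every charge, EVERY vector field; antecedents = the printed
# regularity (1.7) and «e sufficiently small»), obtained AS PRINTED in B4 p. 593–594 from Corollary 2.3; part 2/2 (part 1/2 =
# `B1Prop22RegularFieldAlg`: the matrix `Δ^{(k)}(Ω,A)`, (2.28) exactly, the sources)

statement-level skeleton of published theorems with citation tags; proofs where landed; nothing here is a claim about the Yang–Mills mass gap

PDF held: `paper:balaban1982-cmp85-higgs23-i` (journal page = PDF page + 602), p. 611 read as an image on
`run/shared/lean/pub/pub-balaban/b2b-balaban-ref1/pages/1982-cmp85-higgs23-I/1982-cmp85-higgs23-I-p009-x2.png`; B4 =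
[Balaban1983RegularityDecay] pp. 572–573, 580–581, 593–594 (`…/1983-cmp89-regularity-decay/…-p002, p003, p010, p011,
p023, p024-x2.png`, journal page = PDF page + 570).

CITATION HEADER (lean-in-tree rule).  Cell `lit-balaban` (HOME `run/shared/lean/pub/lit-balaban/`), Phase-2 proof seat
**p17** gen 2 (unit `lit-balaban-p17-g2`); SKELETON row **B1.Prop2.2** (decl of record `…B1.Prop22Small` over the carrier
`…B1.DeltaSetting`, pub-balaban pv07 — UNCHANGED); kind «model instance»; fold owners r01/r14, referee ref-4; companion of
`B1Prop22Proof` (same seat: the `A = 0` instance and the knitting `prop22Small_of_cor23Printed`, reused here BY NAME) and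
of `B1Prop22RegularFieldAlg` (same seat: `deltaK`, `single_deltaK_single`, `single_deltaK_sub`, `src`, `src_dot_self`).
USED BY NAME, never restated (pub-balaban b04 lineage, files untouched): the regular-field carrier
`B4Cor23RegionEta.regularPairSetting` and **`B4Cor23RegionEta.cor23Printed_regularPair`** (Cor. 2.3 typed at `A ≠ 0`),
`B4Lemma21Region.regionOp` (`−Δ^{η,N}_{A,Ω} + m² + a_kP_k(A)` with the block transporters `U(A(Γ_{y,x}))` along the
staircase contours, `B4Cor23RegionDeltaAlg.trn`), `B4Prop31Energy.keff` ((1.14) for arbitrary region data),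
`B4Cor23RegionDeltaAlg.{extV, resV, dGv, contourTrans_incl}` (the nested-region algebra of (1.11)).

WHAT IS PRINTED (verbatim, I p. 611): *"**Proposition 2.2.** If a configuration A is regular in the same sense as in
Proposition 2.1 then there exist constants δ₀ > 0 and c₀, depending on the same quantities as in Proposition 2.1, such
that |Δ^{(k)}(Ω, A; x, x′)| ≦ c₀exp(−δ₀|x − x′|), x, x′ ∈ Ω^{(k)}.  (2.27)  Putting for Ω ⊂ Ω₀ δΔ^{(k)}(Ω, Ω₀, A) =
Δ^{(k)}(Ω, A) − Δ^{(k)}(Ω₀, A),  (2.28)  the following inequality holds |δΔ^{(k)}(Ω, Ω₀, A; x, x′)| ≦ c₀ exp(−δ₀(|x − x′| +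
dist(x, Ω^{(k)c}) + dist(x′, Ω^{(k)c}))).  (2.29)"*; B4 p. 573: *"Δ^{(k)}(Ω, A) = a_kI − a_k²Q_k(A)G_k(Ω, A)Q_k^*(A) (1.14)"*;
B4 p. 593–594: *"Finally Corollary 2.3 implies that the considered operator is short-ranged … (5.4) … and a change of the
domain Ω implies a change of the operator which can be estimated in the following way … (5.5)"*.

DICTIONARY (print ↦ Lean; lattice units `η = 1/n`, counting pairings as in the b04 lineage).  `Q_k(A) = η^{d+1}·Q` with
`Q = avgOp (rBlkWt …) (trn …)` the transported block sums of `regionOp`, `Q_k^*(A) = Qᵀ` (I (2.11): weight-`η^{d+1}`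
pairing below, counting pairing above), `G_k(Ω,A) = (regionOp …)⁻¹`; hence (1.14) is the matrix
`deltaK = a·1 − a²η^{d+1}·Q G Qᵀ = B4Prop31Energy.keff` on the unit sites `Ω^{(k)} × {1,…,N}` (`a` = the print's `a_k`).
`|Δ^{(k)}(Ω,A; y, y′)|` := the operator norm of the `N × N` block, `sup_{|v|=|v′|=1} |⟨vδ_y, Δ^{(k)} v′δ_{y′}⟩|`;
`|δΔ^{(k)}(Ω,Ω₀,A; y,y′)|` := the same for the difference (2.28) (sites of `Ω^{(k)} ⊂ Ω₀^{(k)}` via `incl`); `|y − y′|` :=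
`|y − y′|_∞` (= the η-distance of the base corners `n·y`, `n·y′`); `dist(y, Ω^{(k)c})` := the η-distance from the base
corner of `B(y)` to the fine points of `Ω₀ ∖ Ω` (the b04 reading of the complement inside the ambient region, its
`bdist1`; `0` when `Ω₀ = Ω`).  The sources of the knitting are `f_{y,v} = η^{(d+1)/2}·Qᵀ(vδ_y) = η^{(d+1)/2}·Q_k^*(A)(vδ_y)`:
`‖f_{y,v}‖₂ = |v| = 1` (orthogonality of the transporters, `n^{d+1}` points per block), `supp f_{y,v} = B(y)`.

WHAT IS PROVED (kernel-checked, zero `sorry`, no new `def … : Prop`; axioms standard; the algebra — (2.21) on one-site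
configurations, (2.28) EXACTLY as `−a²⟨f_{y,v}, δG_k(Ω,Ω₀,A)f_{y′,v′}⟩`, `‖f_{y,v}‖₂ = |v|`, `supp f_{y,v} = B(y)` — is part 1/2).
* §4 the geometry with allowance `D = 2`: `|y − y′| ≤ dist(supp f_y, supp f_{y′}) + 2` (`udist_le`), `dist(y,Ω^{(k)c}) ≤
  dist(supp f_y, Ω₀∖Ω) + 2` (`distOc_le`).
* §5 **`prop22Small_regularPair`**: for `N ≥ 1`, every orthogonal flow with `‖(U(t) − 1)v‖ ≤ ℓt‖v‖`, every `a > 0`,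
  `c ≥ 0`, `β > 0`, `M`: `B1.Prop22Small` holds on the family `regDict … i` of ALL regular-field region pairs
  (`B4Cor23RegionEta.RegularPairInstance`: `regular` = (1.7) on `Ω₀` in lattice units, `bigBlocks` = unions of
  `M`-blocks, carried), by `B1Prop22Proof.prop22Small_of_cor23Printed` fed with `cor23Printed_regularPair`;
  **`prop22Small_regularPair_rot`**: the rotation flow (`N = 2`), every flow hypothesis discharged.  Non-vacuity of the
  antecedents below every threshold by non-constant fields: b04's `B4Cor23RegionEta.linPairInst_meets`.
HONEST SCOPE: `a` (= `a_k`) is a family parameter, as in b04's Cor. 2.3 family (uniformity over the window (I (2.15)) is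
asserted only in the `A = 0` file); finite nested block unions (no torus); constants existential (those of
`cor23Printed_regularPair`, `c₀ ↦ max(a,a²)(1 + c₀e^{6δ₀})`).  Value = kernel certificate of a lemma-level statement.
-/

namespace Literature.MathematicalPhysics.QuantumFieldTheory.Balaban1983to89.B1Prop22RegularField

open Finset Matrix
open Literature.MathematicalPhysics.QuantumFieldTheory.Balaban1983to89
open Literature.MathematicalPhysics.QuantumFieldTheory.Balaban1983to89.B4GaugeCovariance (OrthFlow fld fld_apply blockOp
  blockOp_apply avgOp contourTrans)
open Literature.MathematicalPhysics.QuantumFieldTheory.Balaban1983to89.B4Lower18 (fineDom mem_fineDom fineDom_isBlockUnion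
  edistR rblk card_filter_rblk)
open Literature.MathematicalPhysics.QuantumFieldTheory.Balaban1983to89.B4Lower18Regular (transport_fieldLink
  orth_dotProduct_mulVec_self dotProduct_eq_sum_fld dotProduct_self_nonneg' rot_lipschitz)
open Literature.MathematicalPhysics.QuantumFieldTheory.Balaban1983to89.B4Lower18RegularRegion (regWt rBlkWt rbaseEmb
  rstairContour compField rbaseEmb_blk)
open Literature.MathematicalPhysics.QuantumFieldTheory.Balaban1983to89.B4Lemma21Region (regionOp)
open Literature.MathematicalPhysics.QuantumFieldTheory.Balaban1983to89.B4Reflection242 (blk supNorm_le_of_forall)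
open Literature.MathematicalPhysics.QuantumFieldTheory.Balaban1983to89.B4TwoRegion120 (incl incl_injective)
open Literature.MathematicalPhysics.QuantumFieldTheory.Balaban1983to89.B4Cor23Zero (edistR_self edistR_comm edistR_triangle)
open Literature.MathematicalPhysics.QuantumFieldTheory.Balaban1983to89.B4Cor23ZeroDelta (setDist setDist_le outR mem_outR
  inclEmb edistR_incl)
open Literature.MathematicalPhysics.QuantumFieldTheory.Balaban1983to89.B4Cor23Region (bsupp bsuppDist bl2n)
open Literature.MathematicalPhysics.QuantumFieldTheory.Balaban1983to89.B4Cor23RegionDeltaAlg (extV resV dGv fineDom_mono lnk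
  trn contourTrans_incl extV_dotProduct extV_smul fld_extV_incl fld_extV_of_not_mem ext_of_fld fld_smul')
open Literature.MathematicalPhysics.QuantumFieldTheory.Balaban1983to89.B4Cor23RegionDelta (bdistV)
open Literature.MathematicalPhysics.QuantumFieldTheory.Balaban1983to89.B4Cor23RegionEta (RegularPairInstance
  regularPairSetting pairR deltaG dpairR cor23Printed_regularPair)
open Literature.MathematicalPhysics.QuantumFieldTheory.Balaban1983to89.B4Prop31Energy (keff)
open Literature.MathematicalPhysics.QuantumFieldTheory.Balaban1983to89.B4BoxCov237 (supNorm_sub_le_of_blk_eq)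
open Literature.MathematicalPhysics.QuantumFieldTheory.Balaban1983to89.B1Prop22Proof (DictΔ prop22Small_of_cor23Printed)
open Literature.MathematicalPhysics.QuantumFieldTheory.Balaban1983to89.B1Prop22RegularFieldAlg
open Literature.MathematicalPhysics.QuantumFieldTheory.Balaban1983to89.B1Prop22RegularFieldAlg.Inst

noncomputable section

variable {d : ℕ} {ι : Type} [Fintype ι] [DecidableEq ι]

/-! ## §4. Geometry (allowance `D = 2`): base corners, supports `B(y)`, boundary distances -/

/-- two fine points of one `n`-block are at η-distance `≤ 1`. [folklore] -/
private theorem edistR_le_one_of_blk {n : ℕ} (hn : 1 ≤ n) {R : Finset (Fin (d + 1) → ℤ)} (x x' : ↥R)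
    (h : blk n x.1 = blk n x'.1) : edistR n R x x' ≤ 1 := by
  have hn0 : (0 : ℝ) < n := by exact_mod_cast hn
  show (1 / (n : ℝ)) * B4ContourShift.supNorm (x.1 - x'.1) ≤ 1
  calc (1 / (n : ℝ)) * B4ContourShift.supNorm (x.1 - x'.1) ≤ (1 / (n : ℝ)) * ((n : ℝ) - 1) :=
        mul_le_mul_of_nonneg_left (supNorm_sub_le_of_blk_eq hn h) (by positivity)
    _ ≤ 1 := by rw [div_mul_eq_mul_div, one_mul, div_le_one hn0]; linarith

/-- the set distance to the empty set is the junk value `0`. [folklore] -/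
private theorem setDist_empty_right {α : Type*} (dR : α → α → ℝ) (A : Finset α) : setDist dR A ∅ = 0 := by
  unfold setDist; rw [dif_neg]; simp

namespace Inst

variable (i : RegularPairInstance d) (F : OrthFlow ι)

/-- `|y − y′|` read as the η-distance of the base corners `n·y, n·y′` (`= |y − y′|_∞`). [cite: Balaban1982Higgs1, (2.27) p.611] -/
def udist (y y' : ↥i.Ωc) : ℝ := edistR i.n (fineDom i.n i.Ωc) (rbaseEmb i.hn i.Ωc y) (rbaseEmb i.hn i.Ωc y')

/-- the sup norm is homogeneous under the block scaling `z ↦ n·z`. [folklore] -/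
private theorem supNorm_natMul (n : ℕ) (z : Fin (d + 1) → ℤ) :
    B4ContourShift.supNorm (fun j => (n : ℤ) * z j) = (n : ℝ) * B4ContourShift.supNorm z := by
  have habs : ∀ j, (((|(n : ℤ) * z j| : ℤ) : ℝ)) = (n : ℝ) * ((|z j| : ℤ) : ℝ) := fun j => by
    push_cast [abs_mul, Nat.abs_cast]; ring
  refine le_antisymm (supNorm_le_of_forall fun j => ?_) ?_
  · rw [habs]
    exact mul_le_mul_of_nonneg_left (B4ContourShift.abs_le_supNorm z j) (Nat.cast_nonneg n)
  · obtain ⟨j, hj⟩ := B4ContourShift.exists_supNorm_eq z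
    rw [hj, ← habs]
    exact B4ContourShift.abs_le_supNorm (fun j => (n : ℤ) * z j) j

/-- `udist` IS `|y − y′|_∞`, the sup-distance of the unit sites. [cite: Balaban1982Higgs1, (2.27) p.611] -/
theorem udist_eq (y y' : ↥i.Ωc) : udist i y y' = B4ContourShift.supNorm (y.1 - y'.1) := by
  have hn : (i.n : ℝ) ≠ 0 := by have := i.hn; positivity
  have hsub : ((rbaseEmb i.hn i.Ωc y).1 - (rbaseEmb i.hn i.Ωc y').1) = fun j => (i.n : ℤ) * (y.1 - y'.1) j := by
    funext j
    show (i.n : ℤ) * y.1 j - (i.n : ℤ) * y'.1 j = (i.n : ℤ) * (y.1 j - y'.1 j)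
    ring
  unfold udist edistR
  rw [hsub, supNorm_natMul, ← mul_assoc, one_div_mul_cancel hn, one_mul]

/-- `dist(y, Ω^{(k)c})` read as the η-distance from the base corner of `B(y)` to the fine points of `Ω₀ ∖ Ω` (b04's
`bdist1`; `0` when `Ω₀ = Ω`). [cite: Balaban1982Higgs1, (2.29) p.611] -/
def distOc (y : ↥i.Ωc) : ℝ :=
  setDist (edistR i.n (fineDom i.n i.Ω₀c)) {incl (fineDom_mono i.hn i.hsub) (rbaseEmb i.hn i.Ωc y)}
    (outR (fineDom i.n i.Ωc) (fineDom i.n i.Ω₀c))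

/-- **`|y − y′| ≤ dist(supp f_{y,v}, supp f_{y′,v′}) + 2`** (`supp f_{y,v} = B(y)`). [cite: Balaban1982Higgs1, Prop. 2.2 p.611] -/
theorem udist_le (y y' : ↥i.Ωc) {v v' : ι → ℝ} (hv : v ⬝ᵥ v = 1) (hv' : v' ⬝ᵥ v' = 1) :
    udist i y y' ≤ bsuppDist i.n (fineDom i.n i.Ωc) (src i F y v) (src i F y' v') + 2 := by
  have hb : rbaseEmb i.hn i.Ωc y ∈ bsupp (src i F y v) := (mem_bsupp_src_iff i F y hv _).2 (rbaseEmb_blk i.hn i.Ωc y)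
  have hb' : rbaseEmb i.hn i.Ωc y' ∈ bsupp (src i F y' v') :=
    (mem_bsupp_src_iff i F y' hv' _).2 (rbaseEmb_blk i.hn i.Ωc y')
  have hne : (bsupp (src i F y v) ×ˢ bsupp (src i F y' v')).Nonempty := ⟨_, Finset.mk_mem_product hb hb'⟩
  unfold bsuppDist
  rw [dif_pos hne]
  have := Finset.le_inf' hne (fun p => edistR i.n (fineDom i.n i.Ωc) p.1 p.2) (a := udist i y y' - 2) fun p hp => by
    obtain ⟨h1, h2⟩ := Finset.mem_product.1 hp
    have e1 : edistR i.n (fineDom i.n i.Ωc) (rbaseEmb i.hn i.Ωc y) p.1 ≤ 1 :=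
      edistR_le_one_of_blk i.hn _ _ ((rbaseEmb_blk i.hn i.Ωc y).trans ((mem_bsupp_src_iff i F y hv _).1 h1).symm)
    have e2 : edistR i.n (fineDom i.n i.Ωc) p.2 (rbaseEmb i.hn i.Ωc y') ≤ 1 :=
      edistR_le_one_of_blk i.hn _ _ (((mem_bsupp_src_iff i F y' hv' _).1 h2).trans (rbaseEmb_blk i.hn i.Ωc y').symm)
    have t1 := edistR_triangle (n := i.n) (rbaseEmb i.hn i.Ωc y) p.1 (rbaseEmb i.hn i.Ωc y')
    have t2 := edistR_triangle (n := i.n) p.1 p.2 (rbaseEmb i.hn i.Ωc y')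
    show udist i y y' - 2 ≤ edistR i.n (fineDom i.n i.Ωc) p.1 p.2
    unfold udist; linarith
  linarith

/-- **`dist(y, Ω^{(k)c}) ≤ dist(supp f_{y,v}, Ω₀∖Ω) + 2`** (b04's `bdistV`). [cite: Balaban1982Higgs1, Prop. 2.2 p.611] -/
theorem distOc_le (y : ↥i.Ωc) {v : ι → ℝ} (hv : v ⬝ᵥ v = 1) :
    distOc i y ≤ bdistV i.n (fineDom_mono i.hn i.hsub) (src i F y v) + 2 := by
  have hR := fineDom_mono i.hn i.hsub
  have hb : rbaseEmb i.hn i.Ωc y ∈ bsupp (src i F y v) := (mem_bsupp_src_iff i F y hv _).2 (rbaseEmb_blk i.hn i.Ωc y)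
  by_cases hout : (outR (fineDom i.n i.Ωc) (fineDom i.n i.Ω₀c)).Nonempty
  · obtain ⟨z₀, hz₀⟩ := hout
    have hne : (((bsupp (src i F y v)).map (inclEmb hR)) ×ˢ outR (fineDom i.n i.Ωc) (fineDom i.n i.Ω₀c)).Nonempty :=
      ⟨_, Finset.mk_mem_product (Finset.mem_map_of_mem (inclEmb hR) hb) hz₀⟩
    unfold bdistV setDist
    rw [dif_pos hne]
    have := Finset.le_inf' hne (fun p => edistR i.n (fineDom i.n i.Ω₀c) p.1 p.2) (a := distOc i y - 2) fun p hp => by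
      obtain ⟨h1, h2⟩ := Finset.mem_product.1 hp
      obtain ⟨x, hx, hpx⟩ := Finset.mem_map.1 h1
      have d1 : distOc i y ≤ edistR i.n (fineDom i.n i.Ω₀c) (incl hR (rbaseEmb i.hn i.Ωc y)) p.2 :=
        setDist_le _ (Finset.mem_singleton_self _) h2
      have d2 : edistR i.n (fineDom i.n i.Ω₀c) (incl hR (rbaseEmb i.hn i.Ωc y)) p.1 ≤ 1 := by
        rw [← hpx]
        show edistR i.n (fineDom i.n i.Ω₀c) (incl hR (rbaseEmb i.hn i.Ωc y)) (incl hR x) ≤ 1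
        rw [edistR_incl]
        exact edistR_le_one_of_blk i.hn _ _ ((rbaseEmb_blk i.hn i.Ωc y).trans ((mem_bsupp_src_iff i F y hv _).1 hx).symm)
      have t := edistR_triangle (n := i.n) (incl hR (rbaseEmb i.hn i.Ωc y)) p.1 p.2
      show distOc i y - 2 ≤ edistR i.n (fineDom i.n i.Ω₀c) p.1 p.2
      linarith
    linarith
  · have h0 : outR (fineDom i.n i.Ωc) (fineDom i.n i.Ω₀c) = ∅ := Finset.not_nonempty_iff_eq_empty.1 hout
    unfold distOc bdistV
    rw [h0, setDist_empty_right, setDist_empty_right]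
    norm_num

end Inst

/-! ## §5. The dictionary instance and Proposition 2.2 on the regular-field family -/

open Inst

/-- the unit sphere of `R^N`: the test vectors of the block operator norm `|Δ^{(k)}(Ω,A;y,y′)|` in (2.27).
[cite: Balaban1982Higgs1, (2.27) p.611] -/
abbrev Sph (ι : Type) [Fintype ι] : Type := {v : ι → ℝ // v ⬝ᵥ v = 1}

/-- the unit sphere of `R^N` is nonempty for `N ≥ 1`. [folklore] -/
private theorem sph_nonempty [Nonempty ι] : Nonempty (Sph ι) := by
  obtain ⟨j⟩ := ‹Nonempty ι›
  exact ⟨⟨Pi.single j 1, by simp⟩⟩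

/-- the `k = 0` pairing of b04's carrier is `|⟨f, G_k(Ω,A)f′⟩|`. [cite: Balaban1983RegularityDecay, (2.30) p. 580] -/
theorem pair_zero (F : OrthFlow ι) (a c β : ℝ) (M : ℕ) (i : RegularPairInstance d) (μ ν : Fin (d + 1))
    (f f' : ↥(fineDom i.n i.Ωc) × ι → ℝ) :
    (regularPairSetting F a c β M i).pair 0 μ ν f f' = |f ⬝ᵥ ((regionOp F i.e i.hn a i.m2 i.Ωc i.Ac)⁻¹ *ᵥ f')| := by
  show pairR F a i.e i.hn i.m2 i.Ac i.Ωc 0 μ ν f f' = _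
  simp [pairR]

/-- the `k = 0` `δG`-pairing of b04's carrier is `|⟨f, δG_k(Ω,Ω₀,A)f′⟩|`. [cite: Balaban1983RegularityDecay, Cor. 2.3 p. 581] -/
theorem dpair_zero (F : OrthFlow ι) (a c β : ℝ) (M : ℕ) (i : RegularPairInstance d) (μ ν : Fin (d + 1))
    (f f' : ↥(fineDom i.n i.Ωc) × ι → ℝ) :
    (regularPairSetting F a c β M i).dpair 0 μ ν f f' = |f ⬝ᵥ deltaG F a i.e i.hn i.m2 i.hsub i.Ac f'| := by
  show dpairR F a i.e i.hn i.m2 i.hsub i.Ac 0 μ ν f f' = _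
  simp [dpairR]

/-- a generic bound: `|⟨f, Mf′⟩| ≤ Σ|M_{jk}|` when all entries of `f, f′` are `≤ 1` in modulus. [folklore] -/
private theorem abs_dot_mulVec_le {J : Type} [Fintype J] (M : Matrix J J ℝ) {f f' : J → ℝ} (hf : ∀ j, |f j| ≤ 1)
    (hf' : ∀ j, |f' j| ≤ 1) : |f ⬝ᵥ (M *ᵥ f')| ≤ ∑ j, ∑ k, |M j k| := by
  refine (Finset.abs_sum_le_sum_abs _ _).trans (Finset.sum_le_sum fun j _ => ?_)
  rw [abs_mul]
  refine (mul_le_of_le_one_left (abs_nonneg _) (hf j)).trans ?_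
  refine (Finset.abs_sum_le_sum_abs _ _).trans (Finset.sum_le_sum fun k _ => ?_)
  rw [abs_mul]
  exact mul_le_of_le_one_right (abs_nonneg _) (hf' k)
/-- `δG` is linear (scalars). [folklore] -/
private theorem deltaG_smul (F : OrthFlow ι) (a : ℝ) (i : RegularPairInstance d) (r : ℝ)
    (g : ↥(fineDom i.n i.Ωc) × ι → ℝ) :
    deltaG F a i.e i.hn i.m2 i.hsub i.Ac (r • g) = r • deltaG F a i.e i.hn i.m2 i.hsub i.Ac g := by
  unfold deltaG dGv
  rw [Matrix.mulVec_smul, extV_smul, Matrix.mulVec_smul, smul_sub]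
  rfl

/-- **THE CONCRETE DICTIONARY AT `A ≠ 0`.**  Member `i` = a regular-field region pair of b04 (mesh `1/n`, unit labels
`Ωc ⊆ Ω₀c` of `Ω ⊆ Ω₀`, charge `e`, vector field `A_ν(x)`, mass `m²`): the Cor.-2.3 instance is b04's default carrier
`regularPairSetting F a c β M i`; unit sites `y ∈ Ω^{(k)}` = `Ωc`; test vectors = the unit sphere of `R^N`; sources
`f_{y,v} = η^{(d+1)/2}Q_k^*(A)(vδ_y)`; `a₁ = a`, `a₂ = a²`; `|Δ^{(k)}(Ω,A;y,y′)|` and `|δΔ^{(k)}(Ω,Ω₀,A;y,y′)|` = the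
operator norms of the `N × N` blocks of `deltaK` and of its difference (2.28); `|y − y′|`, `dist(y,Ω^{(k)c})` as in §4;
allowance `D = 2`. [cite: Balaban1982Higgs1, Prop. 2.2 (2.27)–(2.29) p.611] -/
def regDict [Nonempty ι] (F : OrthFlow ι) {a : ℝ} (ha : 0 < a) (c β : ℝ) (M : ℕ) (i : RegularPairInstance d) :
    DictΔ 2 (max a (a ^ 2)) where
  S := regularPairSetting F a c β M i
  KSite := ↥i.Ωc
  V := Sph ι
  hV := sph_nonempty
  src := fun y v => src i F y v.1
  μ0 := (0 : Fin (d + 1))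
  a₁ := a
  a₂ := a ^ 2
  ha₁ := ha.le
  ha₁M := le_max_left _ _
  ha₂ := sq_nonneg a
  ha₂M := le_max_right _ _
  udist := udist i
  distOc := distOc i
  ind := fun y y' => if y = y' then 1 else 0
  kerD := fun y y' => ⨆ p : Sph ι × Sph ι,
    |single y p.1.1 ⬝ᵥ (deltaK F i.e i.hn a i.m2 i.Ωc i.Ac *ᵥ single y' p.2.1)|
  kerDD0 := fun y y' => ⨆ p : Sph ι × Sph ι,
    |single y p.1.1 ⬝ᵥ (deltaK F i.e i.hn a i.m2 i.Ωc i.Ac *ᵥ single y' p.2.1)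
      - single (incl i.hsub y) p.1.1 ⬝ᵥ (deltaK F i.e i.hn a i.m2 i.Ω₀c i.Ac *ᵥ single (incl i.hsub y') p.2.1)|
  ind_le_one := fun y y' => by split_ifs <;> norm_num
  ind_off := fun y y' h => by
    split_ifs with hy
    · subst hy; exact absurd h (by unfold udist; rw [edistR_self]; exact lt_irrefl 0)
    · exact le_rfl
  l2_nonneg := fun y v => Real.sqrt_nonneg _
  l2_le_one := fun y v => by
    show Real.sqrt (src i F y v.1 ⬝ᵥ src i F y v.1) ≤ 1
    rw [src_dot_self, v.2, Real.sqrt_one]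
  kerD_le := fun y y' => by
    haveI := sph_nonempty (ι := ι)
    have hs := (sR_pos i).le
    have hbdd : BddAbove (Set.range fun p : Sph ι × Sph ι =>
        (regularPairSetting F a c β M i).pair 0 (0 : Fin (d + 1)) (0 : Fin (d + 1)) (src i F y p.1.1) (src i F y' p.2.1)) := by
      refine ⟨∑ j, ∑ k, |((regionOp F i.e i.hn a i.m2 i.Ωc i.Ac)⁻¹) j k|, ?_⟩
      rintro _ ⟨p, rfl⟩
      exact (pair_zero F a c β M i 0 0 _ _).le.trans
        (abs_dot_mulVec_le _ (abs_src_le i F y p.1.2) (abs_src_le i F y' p.2.2))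
    refine ciSup_le fun p => ?_
    have hs' : (0 : ℝ) ≤ ((i.n : ℝ) ^ (d + 1))⁻¹ := hs
    have hvv : |p.1.1 ⬝ᵥ p.2.1| ≤ 1 := by
      rw [abs_le]
      have h1 := dotProduct_self_nonneg' (p.1.1 - p.2.1)
      have h2 := dotProduct_self_nonneg' (p.1.1 + p.2.1)
      simp only [sub_dotProduct, dotProduct_sub, add_dotProduct, dotProduct_add, p.1.2, p.2.2,
        dotProduct_comm p.2.1 p.1.1] at h1 h2
      constructor <;> linarith
    have hind : |(if y = y' then p.1.1 ⬝ᵥ p.2.1 else 0 : ℝ)| ≤ if y = y' then 1 else 0 := by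
      split_ifs
      · exact hvv
      · simp
    have hpair : ((i.n : ℝ) ^ (d + 1))⁻¹ * |qsrc i F y p.1.1 ⬝ᵥ ((regionOp F i.e i.hn a i.m2 i.Ωc i.Ac)⁻¹ *ᵥ
        qsrc i F y' p.2.1)| = (regularPairSetting F a c β M i).pair 0 (0 : Fin (d + 1)) (0 : Fin (d + 1)) (src i F y p.1.1) (src i F y' p.2.1) := by
      rw [pair_zero, src, src, smul_dotProduct, Matrix.mulVec_smul, dotProduct_smul, smul_eq_mul, smul_eq_mul,
        ← mul_assoc, Real.mul_self_sqrt hs, abs_mul, abs_of_nonneg hs]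
      rfl
    calc |single y p.1.1 ⬝ᵥ (deltaK F i.e i.hn a i.m2 i.Ωc i.Ac *ᵥ single y' p.2.1)|
        = |a * (if y = y' then p.1.1 ⬝ᵥ p.2.1 else 0) - a ^ 2 * (((i.n : ℝ) ^ (d + 1))⁻¹ *
            (qsrc i F y p.1.1 ⬝ᵥ ((regionOp F i.e i.hn a i.m2 i.Ωc i.Ac)⁻¹ *ᵥ qsrc i F y' p.2.1)))| := by
          rw [single_deltaK_single, mul_assoc]; rfl
      _ ≤ a * |(if y = y' then p.1.1 ⬝ᵥ p.2.1 else 0 : ℝ)| + a ^ 2 * (((i.n : ℝ) ^ (d + 1))⁻¹ *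
            |qsrc i F y p.1.1 ⬝ᵥ ((regionOp F i.e i.hn a i.m2 i.Ωc i.Ac)⁻¹ *ᵥ qsrc i F y' p.2.1)|) := by
          refine (abs_sub _ _).trans (le_of_eq ?_)
          rw [abs_mul, abs_mul, abs_mul, abs_of_pos ha, abs_of_nonneg (sq_nonneg a), abs_of_nonneg hs']
      _ ≤ a * (if y = y' then 1 else 0 : ℝ) + a ^ 2 * ⨆ p : Sph ι × Sph ι,
            (regularPairSetting F a c β M i).pair 0 (0 : Fin (d + 1)) (0 : Fin (d + 1)) (src i F y p.1.1) (src i F y' p.2.1) :=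
          add_le_add (mul_le_mul_of_nonneg_left hind ha.le)
            (mul_le_mul_of_nonneg_left (hpair.le.trans (le_ciSup hbdd p)) (sq_nonneg a))
  kerDD0_le := fun y y' => by
    have hs := (sR_pos i).le
    have hs' : (0 : ℝ) ≤ ((i.n : ℝ) ^ (d + 1))⁻¹ := hs
    have hpt : ∀ p : Sph ι × Sph ι,
        |single y p.1.1 ⬝ᵥ (deltaK F i.e i.hn a i.m2 i.Ωc i.Ac *ᵥ single y' p.2.1)
          - single (incl i.hsub y) p.1.1 ⬝ᵥ (deltaK F i.e i.hn a i.m2 i.Ω₀c i.Ac *ᵥ single (incl i.hsub y') p.2.1)|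
        = a ^ 2 * (regularPairSetting F a c β M i).dpair 0 (0 : Fin (d + 1)) (0 : Fin (d + 1)) (src i F y p.1.1) (src i F y' p.2.1) := by
      intro p
      rw [single_deltaK_sub F i.e i.hn a i.m2 i.Ac i.hsub, dpair_zero, src, src, deltaG_smul, smul_dotProduct,
        dotProduct_smul, smul_eq_mul, smul_eq_mul, ← mul_assoc, Real.mul_self_sqrt hs, abs_neg, abs_mul, abs_mul,
        abs_mul, abs_of_nonneg (sq_nonneg a), abs_of_nonneg hs, abs_of_nonneg hs', mul_assoc]
      rfl
    simp_rw [hpt]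
    rw [← Real.mul_iSup_of_nonneg (sq_nonneg a)]
  udist_le := fun y y' v v' => udist_le i F y y' v.2 v'.2
  distOc_le := fun y v => distOc_le i F y v.2

/-- **PROPOSITION 2.2 AT `A ≠ 0` — THE MODEL INSTANCE ON THE REGULAR-FIELD REGION PAIRS.**  For `N ≥ 1`, every
orthogonal flow `U` with `‖(U(t) − 1)v‖² ≤ (ℓt)²‖v‖²`, every `a > 0` (= `a_k`), `c ≥ 0`, `β > 0` and big-block size `M`,
there are `δ₀, c₀, e₁ > 0` such that for EVERY mesh `η = 1/n`, EVERY nested pair `Ω ⊆ Ω₀` of finite unions of unit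
blocks, every `m² ≥ 0`, every charge `0 < e ≤ e₁` and EVERY vector field `A` regular in the sense (1.7)
(`|A_ν(x+e_μ) − A_ν(x)| ≤ ce^{β−1}η` on `Ω₀`): `|Δ^{(k)}(Ω,A;y,y′)| ≤ c₀e^{−δ₀|y−y′|}` ((2.27)) and
`|δΔ^{(k)}(Ω,Ω₀,A;y,y′)| ≤ c₀e^{−δ₀(|y−y′| + dist(y,Ω^{(k)c}) + dist(y′,Ω^{(k)c}))}` ((2.29)), `Δ^{(k)}(Ω,A) = a_kI −
a_k²Q_k(A)G_k(Ω,A)Q_k^*(A)` with the transporters along the block contours — the typed `B1.Prop22Small` on the family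
`regDict`, from b04's Corollary 2.3 (`cor23Printed_regularPair`) by the printed route B4 p. 593–594
(`B1Prop22Proof.prop22Small_of_cor23Printed`). [cite: Balaban1982Higgs1, Prop. 2.2 (2.27)–(2.29) p.611] -/
theorem prop22Small_regularPair [Nonempty ι] (F : OrthFlow ι) {ℓ : ℝ} (hℓ : 0 ≤ ℓ)
    (hLip : ∀ t (v : ι → ℝ), ((F.U t - 1) *ᵥ v) ⬝ᵥ ((F.U t - 1) *ᵥ v) ≤ (ℓ * t) ^ 2 * (v ⬝ᵥ v))
    {a : ℝ} (ha : 0 < a) {c : ℝ} (hc : 0 ≤ c) {β : ℝ} (hβ : 0 < β) (M : ℕ) :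
    B1.Prop22Small (fun i : RegularPairInstance d => (regDict F ha c β M i).toDelta) :=
  prop22Small_of_cor23Printed (by norm_num) (lt_max_of_lt_left ha) _ (cor23Printed_regularPair F hℓ hLip ha hc hβ M)

/-- Proposition 2.2 at `A ≠ 0` for the ROTATION FLOW (`N = 2`, `ℓ = 1`): every flow hypothesis discharged.
[cite: Balaban1982Higgs1, Prop. 2.2 (2.27)–(2.29) p.611] -/
theorem prop22Small_regularPair_rot {a : ℝ} (ha : 0 < a) {c : ℝ} (hc : 0 ≤ c) {β : ℝ} (hβ : 0 < β) (M : ℕ) :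
    B1.Prop22Small (fun i : RegularPairInstance d => (regDict OrthFlow.rot ha c β M i).toDelta) :=
  prop22Small_regularPair OrthFlow.rot zero_le_one rot_lipschitz ha hc hβ M

/-- READING OF THE INSTANCE: the kernel of the linked `DeltaSetting` IS the block operator norm of (1.14) on the region,
its antecedents ARE b04's (1.7) on `Ω₀` and the big-block property, its charge IS `e`. [cite: Balaban1982Higgs1, Prop. 2.2 p.611] -/
theorem regDict_kerD [Nonempty ι] (F : OrthFlow ι) {a : ℝ} (ha : 0 < a) (c β : ℝ) (M : ℕ) (i : RegularPairInstance d)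
    (y y' : ↥i.Ωc) :
    (regDict F ha c β M i).toDelta.kerD y y' = ⨆ p : Sph ι × Sph ι,
      |single y p.1.1 ⬝ᵥ (deltaK F i.e i.hn a i.m2 i.Ωc i.Ac *ᵥ single y' p.2.1)| ∧
    (regDict F ha c β M i).toDelta.e = i.e ∧
    ((regDict F ha c β M i).toDelta.regular ↔ ∀ x ∈ fineDom i.n i.Ω₀c, ∀ μ ν : Fin (d + 1),
      |i.Ac (x + B4Lower18Regular.e1 μ) ν - i.Ac x ν| ≤ c * i.e ^ (β - 1) / i.n) :=
  ⟨rfl, rfl, Iff.rfl⟩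

end

end Literature.MathematicalPhysics.QuantumFieldTheory.Balaban1983to89.B1Prop22RegularField
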